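import Summits.BirchSwinnertonDyer.BirchSwinnertonDyer.Theorems.SylvesterTwoHeegnerIndexUpperOffV0DescentDefectClaimA
import HarnessLib

/-!
# K7t crux `UpperOffV0HSY` (item 19581): Kolyvagin's descent modulo `p^M` without parity —
# Claim B for classes independent of `x`, off the socle configuration

Second file of the parity-free abstract count (see `…UpperOffV0DescentDefectClaimA` for the design and
the dictionary with the tree's `KolyvaginDescent.HypothesesM`).  Here: Step B (`exists_prime_stepB`:
Cor. 3.2 for the triple `{x, s, c(ℓ)}` or the pair `{x, s}`, OR the socle configuration
`p^{k-1} c(ℓ) = u · p^{M-1} x`), Step C with defects (`stepC_defect`), and **Claim B off the socle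
configuration** (`claimB_indep_defect`: `p^{2M₀+2δ} s = 0` for `s ∈ Sel^{ε}` with `ℤ x ∩ ℤ s = 0`).
Route `SylvesterTwoHeegnerIndex` (cell bsd-cm, rung K7t), line `offv0-kolyvagin2`, stub (f)+(g); NOT the
crux (B14 = O12 open as a class).  Pure algebra, no definition, no named fact.
-/

noncomputable section

open scoped Classical

set_option autoImplicit false
set_option linter.dupNamespace false

namespace Summit.BirchSwinnertonDyer.BirchSwinnertonDyer.Theorems.SylvesterTwoUpper.DescentDefect

open Literature.NumberTheory.EllipticCurves.KolyvaginDescent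

variable {V : Type*} [AddCommGroup V] {p M : ℕ}
variable {Pl : Type*} {M₀ δ : ℕ} {τ : V →+ V} {Sel : AddSubgroup V} {Loc : Pl → AddSubgroup V}
  {Kol : ℕ → Prop} {pl : ℕ → Pl} {Dv : Pl → ℕ → Prop} {A : ℕ → AddSubgroup V} {x : V} {ε : ℤ}
  {c : ℕ → V}

/-! ## §4 Claim B without parity -/

/-- **Step B of Claim B, parity-free.** For `s ∈ V^{ε}` independent of `x` with `ord s = p^N`,
`N ≠ 0`, and a class `d ∈ V^{-ε}` with `ord d = p^k`, `k ≠ 0` (in the application `d = c(ℓ)`): above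
any bound `b` EITHER there is a Kolyvagin prime `ℓ'` with `x_{λ'} = 0`, `ord s_{λ'} = p^N` and
`ord d_{λ'} = p^k` (Cor. 3.2 for the triple `{x, s, d}` when it is independent, or for the pair `{x, s}`
when the dependence runs through the socle of `s`), OR the socles of `ℤ d` and `ℤ x` coincide:
`p^{k-1} d = u · p^{M-1} x` with `p ∤ u` — the one configuration invisible to odd `p` (there
`2 · (a₂ d) = 0` forces `a₂ d = 0`, `HypothesesM.indep_of_eigen₃`).
[cite: McCallumLMS1991, Cor. 3.2, §5 (proof of Thm. 5.4)] [cite: GrossLMS1991, §10 Claim 10.3] -/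
theorem exists_prime_stepB (hp : p.Prime) (torsion : ∀ v : V, ((p : ℤ) ^ M) • v = 0)
    (x_ord : ((p : ℤ) ^ (M - 1)) • x ≠ 0) (hε : ε = 1 ∨ ε = -1) (τ_x : τ x = ε • x)
    (cebotarev : ∀ (r : ℕ) (cs : Fin r → V) (Nv : Fin r → ℕ), (∀ i, cs i ≠ 0) →
      (∀ i, Nv i ≠ 0 → ((p : ℤ) ^ (Nv i - 1)) • cs i ≠ 0) →
      (∀ i, ∃ e : ℤ, (e = 1 ∨ e = -1) ∧ τ (cs i) = e • cs i) →
      (∀ a : Fin r → ℤ, ∑ i, a i • cs i = 0 → ∀ i, a i • cs i = 0) →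
      ∀ b : ℕ, ∃ ℓ, b < ℓ ∧ Kol ℓ ∧ ∀ i, ((p : ℤ) ^ Nv i) • cs i ∈ A ℓ ∧
        (Nv i ≠ 0 → ((p : ℤ) ^ (Nv i - 1)) • cs i ∉ A ℓ))
    {s : V} (hτs : τ s = ε • s) (hind : ∀ a₀ a₁ : ℤ, a₀ • x + a₁ • s = 0 → a₁ • s = 0)
    {N : ℕ} (hN0 : N ≠ 0) (hN : ((p : ℤ) ^ N) • s = 0) (hN1 : ((p : ℤ) ^ (N - 1)) • s ≠ 0)
    {d : V} (hτd : τ d = (-ε) • d)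
    {k : ℕ} (hk0 : k ≠ 0) (hk : ((p : ℤ) ^ k) • d = 0) (hk1 : ((p : ℤ) ^ (k - 1)) • d ≠ 0)
    (b : ℕ) :
    (∃ ℓ', b < ℓ' ∧ Kol ℓ' ∧ x ∈ A ℓ' ∧ ((p : ℤ) ^ (N - 1)) • s ∉ A ℓ' ∧
      ((p : ℤ) ^ (k - 1)) • d ∉ A ℓ') ∨
    (∃ u : ℤ, ¬ (p : ℤ) ∣ u ∧ ((p : ℤ) ^ (k - 1)) • d = u • (((p : ℤ) ^ (M - 1)) • x)) := by
  have he := sign_mul_self hε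
  have hxne : x ≠ 0 := fun h ↦ x_ord (by rw [h, smul_zero])
  have hsne : s ≠ 0 := fun h ↦ hN1 (by rw [h, smul_zero])
  have hdne : d ≠ 0 := fun h ↦ hk1 (by rw [h, smul_zero])
  have hM0 : M ≠ 0 := by
    intro h
    apply x_ord
    have := torsion x
    rwa [h] at this ⊢
  -- independence of the pair `{x, s}` in the symmetric form
  have hind₂ : ∀ a₀ a₁ : ℤ, a₀ • x + a₁ • s = 0 → a₀ • x = 0 ∧ a₁ • s = 0 := fun a₀ a₁ h ↦ by
    have h1 := hind a₀ a₁ h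
    rw [h1, add_zero] at h
    exact ⟨h, h1⟩
  by_cases H3 : ∀ a₀ a₁ a₂ : ℤ, a₀ • x + a₁ • s + a₂ • d = 0 → a₂ • d = 0
  · -- the triple `{x, s, d}` is independent: Cor. 3.2 for it
    left
    obtain ⟨ℓ', hlt, hℓ', hloc'⟩ := cebotarev 3 ![x, s, d] ![0, N, k]
      (fun i ↦ by
        fin_cases i
        · exact hxne
        · exact hsne
        · exact hdne)
      (fun i ↦ by
        fin_cases i
        · intro h
          exact absurd rfl h
        · intro _
          exact hN1
        · intro _
          exact hk1)
      (fun i ↦ by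
        fin_cases i
        · exact ⟨ε, hε, τ_x⟩
        · exact ⟨ε, hε, hτs⟩
        · exact ⟨-ε, neg_sign hε, hτd⟩)
      (fun a ha i ↦ by
        rw [Fin.sum_univ_three] at ha
        simp only [Matrix.cons_val_zero, Matrix.cons_val_one, Matrix.cons_val] at ha
        have h2 := H3 _ _ _ ha
        rw [h2, add_zero] at ha
        have h01 := hind₂ _ _ ha
        fin_cases i
        · exact h01.1
        · exact h01.2
        · exact h2) b
    refine ⟨ℓ', hlt, hℓ', ?_, ?_, ?_⟩
    · simpa using (hloc' 0).1
    · have := (hloc' 1).2 (by simpa using hN0)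
      simpa using this
    · have := (hloc' 2).2 (by simpa using hk0)
      simpa using this
  · -- a relation with `a₂ d ≠ 0`: then `2 · a₂ d = 0`, so `p = 2` and `a₂ d` is the socle of `ℤ d`
    push Not at H3
    obtain ⟨a₀, a₁, a₂, hrel, ha₂⟩ := H3
    have hτrel : (a₀ * ε) • x + (a₁ * ε) • s + (-(a₂ * ε)) • d = 0 := by
      have := congrArg τ hrel
      rw [map_add, map_add, map_zsmul, map_zsmul, map_zsmul, map_zero, τ_x, hτs, hτd, smul_smul,
        smul_smul, smul_smul] at this
      rw [← this]
      congr 1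
      ring_nf
    have h2 : (2 : ℤ) • (a₂ • d) = 0 := by
      linear_combination (norm := module) hrel - ε • hτrel + he • (a₀ • x + a₁ • s - a₂ • d)
    by_cases hp2 : p = 2
    swap
    · exact absurd (eq_zero_of_two_zsmul_of_pow hp hp2 torsion h2) ha₂
    have hpd : (p : ℤ) • (a₂ • d) = 0 := by
      rw [hp2]
      exact_mod_cast h2
    obtain ⟨m', hm', hm'eq⟩ := exists_unit_zsmul_socle hp hk0 hk hk1 rfl ha₂ hpd
    have hrel' : a₂ • d = -(a₀ • x + a₁ • s) := eq_neg_of_add_eq_zero_right hrel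
    -- `p a₀ x + p a₁ s = 0`, so `p (a₁ s) = 0`
    have hps : (p : ℤ) • (a₁ • s) = 0 := by
      have h0 : ((p : ℤ) * a₀) • x + ((p : ℤ) * a₁) • s = 0 := by
        rw [mul_zsmul, mul_zsmul, ← zsmul_add, ← neg_neg (a₀ • x + a₁ • s), ← hrel', zsmul_neg,
          hpd, neg_zero]
      have := hind _ _ h0
      rwa [mul_zsmul] at this
    by_cases ha₁ : a₁ • s = 0
    · -- the socles of `ℤ d` and `ℤ x` coincide
      right
      rw [ha₁, add_zero] at hrel'
      obtain ⟨m'', -, hm''eq⟩ := exists_unit_zsmul_socle hp (k := M) hM0 (torsion x) x_ord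
        (t := a₂ • d) (m := -a₀) (by rw [hrel', neg_zsmul]) ha₂ hpd
      obtain ⟨w, hw⟩ := exists_mul_zsmul_eq_of_not_dvd hp torsion hm'
      have hkey : ((p : ℤ) ^ (k - 1)) • d = (w * m'') • (((p : ℤ) ^ (M - 1)) • x) := by
        rw [← hw (((p : ℤ) ^ (k - 1)) • d), mul_zsmul, ← hm'eq, hm''eq, smul_smul]
      refine ⟨w * m'', fun ⟨q, hq⟩ ↦ hk1 ?_, hkey⟩
      rw [hkey, hq, mul_comm (p : ℤ) q, mul_zsmul, smul_smul (p : ℤ), ← pow_succ',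
        show M - 1 + 1 = M by omega, torsion, zsmul_zero]
    · -- the dependence runs through the socle of `s`: Cor. 3.2 for the pair `{x, s}`
      left
      obtain ⟨n', hn', hn'eq⟩ := exists_unit_zsmul_socle hp hN0 hN hN1 rfl ha₁ hps
      obtain ⟨ℓ', hlt, hℓ', hloc'⟩ := cebotarev 2 ![x, s] ![0, N]
        (fun i ↦ by
          fin_cases i
          · exact hxne
          · exact hsne)
        (fun i ↦ by
          fin_cases i
          · intro h
            exact absurd rfl h
          · intro _
            exact hN1)
        (fun i ↦ by
          fin_cases i
          · exact ⟨ε, hε, τ_x⟩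
          · exact ⟨ε, hε, hτs⟩)
        (fun a ha i ↦ by
          rw [Fin.sum_univ_two] at ha
          simp only [Matrix.cons_val_zero, Matrix.cons_val_one] at ha
          have h01 := hind₂ _ _ ha
          fin_cases i
          · exact h01.1
          · exact h01.2) b
      have hxA : x ∈ A ℓ' := by simpa using (hloc' 0).1
      have hsA : ((p : ℤ) ^ (N - 1)) • s ∉ A ℓ' := by
        have := (hloc' 1).2 (by simpa using hN0)
        simpa using this
      refine ⟨ℓ', hlt, hℓ', hxA, hsA, fun hmem ↦ hsA ?_⟩
      -- `a₂ d ∈ A ℓ'`, hence `a₁ s ∈ A ℓ'`, hence its unit multiple `p^{N-1} s`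
      have h1 : a₂ • d ∈ A ℓ' := by
        rw [hm'eq]
        exact (A ℓ').zsmul_mem hmem _
      have h2 : a₁ • s ∈ A ℓ' := by
        have : a₁ • s = -(a₂ • d) - a₀ • x := by rw [hrel']; abel
        rw [this]
        exact (A ℓ').sub_mem ((A ℓ').neg_mem h1) ((A ℓ').zsmul_mem hxA _)
      rw [hn'eq, unit_zsmul_mem_iff hp torsion hn'] at h2
      exact h2

/-- **Step C of Claim B, parity-free, with defects.** For Kolyvagin primes `ℓ ≠ ℓ'` with
`p^{M₀+δ} c(ℓ') = 0` (Prop. 10.2, from `x_{λ'} = 0`) and `ord c(ℓ)_{λ'} ≥ p^{k'}` with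
`M₀ + δ + 1 ≤ k' ≤ M`: the class `d' = p^{M₀+δ} c_M(ℓℓ') ∈ V^{ε}` satisfies the Selmer condition off
`λ'` (Lemma 4.3 off `ℓℓ'`, Prop. 4.4 at `λ`) and `ord d'_{λ'} ≥ p^{k' - M₀ - δ}` (Prop. 4.4 at `λ'`), so
the duality with defect `δ` gives `p^{M - k' + M₀ + 2δ} s_{λ'} = 0` for every `s ∈ Sel^{ε}`.
[cite: McCallumLMS1991, Lemma 4.3, Prop. 4.4, Lemma 5.3] [cite: GrossLMS1991, §10 Claim 10.3] -/
theorem stepC_defect (prime_of_kol : ∀ ℓ, Kol ℓ → ℓ.Prime)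
    (dv_iff : ∀ ℓ, Kol ℓ → ∀ v, Dv v ℓ ↔ v = pl ℓ)
    (dv_mul : ∀ ℓ ℓ', Kol ℓ → Kol ℓ' → ∀ v, Dv v (ℓ * ℓ') → Dv v ℓ ∨ Dv v ℓ')
    (hε : ε = 1 ∨ ε = -1)
    (τ_c : ∀ n, KolSupp Kol n → τ (c n) = (ε * (-1) ^ n.primeFactors.card) • c n)
    (c_mem_loc : ∀ n, KolSupp Kol n → ∀ v, ¬ Dv v n → c n ∈ Loc v)
    (c_mem_loc_iff : ∀ ℓ m, Kol ℓ → KolSupp Kol (ℓ * m) → ∀ a : ℕ,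
      (((p : ℤ) ^ a) • c (ℓ * m) ∈ Loc (pl ℓ)) ↔ ((p : ℤ) ^ a) • c m ∈ A ℓ)
    (duality : ∀ ℓ, Kol ℓ → ∀ ν : ℤ, (ν = 1 ∨ ν = -1) → ∀ d, τ d = ν • d →
      (∀ v, v ≠ pl ℓ → d ∈ Loc v) → ∀ s ∈ Sel, τ s = ν • s →
      ∀ a, a < M → ((p : ℤ) ^ a) • d ∉ Loc (pl ℓ) → ((p : ℤ) ^ (M - 1 - a + δ)) • s ∈ A ℓ)
    {ℓ ℓ' : ℕ} (hℓ : Kol ℓ) (hℓ' : Kol ℓ') (hne : ℓ ≠ ℓ')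
    (hcℓ' : ((p : ℤ) ^ (M₀ + δ)) • c ℓ' = 0) {k' : ℕ} (hk'M : k' ≤ M) (hk'lo : M₀ + δ + 1 ≤ k')
    (hcA : ((p : ℤ) ^ (k' - 1)) • c ℓ ∉ A ℓ')
    {s : V} (hs : s ∈ Sel) (hτs : τ s = ε • s) :
    ((p : ℤ) ^ (M - k' + M₀ + 2 * δ)) • s ∈ A ℓ' := by
  have hsupp : KolSupp Kol (ℓ * ℓ') :=
    kolSupp_mul (prime_of_kol ℓ hℓ) (prime_of_kol ℓ' hℓ') hne hℓ hℓ'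
  have hsupp' : KolSupp Kol (ℓ' * ℓ) := by rwa [mul_comm] at hsupp
  set d' := ((p : ℤ) ^ (M₀ + δ)) • c (ℓ * ℓ') with hd'
  have hτd' : τ d' = ε • d' := by
    simp only [hd', map_zsmul, τ_c_mul prime_of_kol τ_c hℓ hℓ' hne, smul_comm _ ε]
  have hatℓ : d' ∈ Loc (pl ℓ) :=
    (c_mem_loc_iff ℓ ℓ' hℓ hsupp (M₀ + δ)).mpr (by rw [hcℓ']; exact zero_mem _)
  have hoff : ∀ v, v ≠ pl ℓ' → d' ∈ Loc v := by
    intro v hv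
    by_cases hvℓ : v = pl ℓ
    · rw [hvℓ]
      exact hatℓ
    by_cases hdv : Dv v (ℓ * ℓ')
    · rcases dv_mul ℓ ℓ' hℓ hℓ' v hdv with h | h
      · exact absurd ((dv_iff ℓ hℓ v).mp h) hvℓ
      · exact absurd ((dv_iff ℓ' hℓ' v).mp h) hv
    · exact (Loc v).zsmul_mem (c_mem_loc _ hsupp v hdv) _
  -- at `λ'`: `p^{k' - 1 - (M₀ + δ)} d' ∉ Loc λ'`
  have hat : ((p : ℤ) ^ (k' - 1 - (M₀ + δ))) • d' ∉ Loc (pl ℓ') := by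
    intro h
    rw [hd', smul_smul, ← pow_add,
      show k' - 1 - (M₀ + δ) + (M₀ + δ) = k' - 1 by omega, mul_comm ℓ ℓ'] at h
    exact hcA ((c_mem_loc_iff ℓ' ℓ hℓ' hsupp' (k' - 1)).mp h)
  have hdual := duality ℓ' hℓ' ε hε d' hτd' hoff s hs hτs (k' - 1 - (M₀ + δ)) (by omega) hat
  rwa [show M - 1 - (k' - 1 - (M₀ + δ)) + δ = M - k' + M₀ + 2 * δ by omega] at hdual

/-- **Claim B for classes independent of `x`, parity-free, with defects, OFF the socle
configuration: `p^{2M₀+2δ} s = 0`** for `s ∈ Sel^{ε}` with `ℤ x ∩ ℤ s = 0`, granted that no Kolyvagin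
class `c(ℓ)` meets `ℤ x` non-trivially (`hsoc`; automatic for odd `p`, where it is
`HypothesesM.indep_of_eigen`).  Mod-`p^M` Claim 10.3 as in the tree's `HypothesesM.claimB_indep` with
`M₀ ↦ M₀ + δ` in Prop. 10.2 and in the duality: Step A (Cor. 3.2 for `{y}`: `ord c(ℓ) ≥ p^{M-M₀}`),
Step B (`exists_prime_stepB`), Step C (`stepC_defect` with `k' = k`).
[cite: GrossLMS1991, §10 Claim 10.3] [cite: McCallumLMS1991, §5 (proof of Thm. 5.4)] -/
theorem claimB_indep_defect (hp : p.Prime) (torsion : ∀ v : V, ((p : ℤ) ^ M) • v = 0)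
    (mem_sel_iff : ∀ s, s ∈ Sel ↔ ∀ v, s ∈ Loc v)
    (prime_of_kol : ∀ ℓ, Kol ℓ → ℓ.Prime)
    (dv_iff : ∀ ℓ, Kol ℓ → ∀ v, Dv v ℓ ↔ v = pl ℓ)
    (dv_mul : ∀ ℓ ℓ', Kol ℓ → Kol ℓ' → ∀ v, Dv v (ℓ * ℓ') → Dv v ℓ ∨ Dv v ℓ')
    (x_ord : ((p : ℤ) ^ (M - 1)) • x ≠ 0) (hε : ε = 1 ∨ ε = -1) (τ_x : τ x = ε • x)
    (c_one : c 1 = ((p : ℤ) ^ M₀) • x)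
    (τ_c : ∀ n, KolSupp Kol n → τ (c n) = (ε * (-1) ^ n.primeFactors.card) • c n)
    (c_mem_loc : ∀ n, KolSupp Kol n → ∀ v, ¬ Dv v n → c n ∈ Loc v)
    (c_mem_loc_iff : ∀ ℓ m, Kol ℓ → KolSupp Kol (ℓ * m) → ∀ a : ℕ,
      (((p : ℤ) ^ a) • c (ℓ * m) ∈ Loc (pl ℓ)) ↔ ((p : ℤ) ^ a) • c m ∈ A ℓ)
    (duality : ∀ ℓ, Kol ℓ → ∀ ν : ℤ, (ν = 1 ∨ ν = -1) → ∀ d, τ d = ν • d →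
      (∀ v, v ≠ pl ℓ → d ∈ Loc v) → ∀ s ∈ Sel, τ s = ν • s →
      ∀ a, a < M → ((p : ℤ) ^ a) • d ∉ Loc (pl ℓ) → ((p : ℤ) ^ (M - 1 - a + δ)) • s ∈ A ℓ)
    (cebotarev : ∀ (r : ℕ) (cs : Fin r → V) (Nv : Fin r → ℕ), (∀ i, cs i ≠ 0) →
      (∀ i, Nv i ≠ 0 → ((p : ℤ) ^ (Nv i - 1)) • cs i ≠ 0) →
      (∀ i, ∃ e : ℤ, (e = 1 ∨ e = -1) ∧ τ (cs i) = e • cs i) →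
      (∀ a : Fin r → ℤ, ∑ i, a i • cs i = 0 → ∀ i, a i • cs i = 0) →
      ∀ b : ℕ, ∃ ℓ, b < ℓ ∧ Kol ℓ ∧ ∀ i, ((p : ℤ) ^ Nv i) • cs i ∈ A ℓ ∧
        (Nv i ≠ 0 → ((p : ℤ) ^ (Nv i - 1)) • cs i ∉ A ℓ))
    (hsoc : ∀ ℓ, Kol ℓ → ∀ a₀ a₂ : ℤ, a₂ • c ℓ = a₀ • x → a₂ • c ℓ = 0)
    {s : V} (hs : s ∈ Sel) (hτs : τ s = ε • s)
    (hind : ∀ a₀ a₁ : ℤ, a₀ • x + a₁ • s = 0 → a₁ • s = 0) :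
    ((p : ℤ) ^ (2 * M₀ + 2 * δ)) • s = 0 := by
  rcases Nat.lt_or_ge (2 * M₀ + 2 * δ) M with hM | hM
  swap
  · exact pow_zsmul_eq_zero_of_le hM (torsion s)
  have hM₀ : M₀ < M := by omega
  obtain ⟨N, -, hN, hNmin⟩ := exists_exact_exponent torsion s
  by_cases hN0 : N = 0
  · subst hN0
    rw [pow_zero, one_zsmul] at hN
    rw [hN, smul_zero]
  have hN1 : ((p : ℤ) ^ (N - 1)) • s ≠ 0 := hNmin (N - 1) (by omega)
  -- Step A: a Kolyvagin prime `ℓ` with `ord y_λ = ord y = p^{M - M₀}`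
  set y : V := ((p : ℤ) ^ M₀) • x with hy
  obtain ⟨hy0, hy1⟩ := y_exact (M₀ := M₀) torsion x_ord hM₀
  have hyne : y ≠ 0 := fun h ↦ hy1 (by rw [← hy, h, smul_zero])
  obtain ⟨ℓ, -, hℓ, hloc⟩ := cebotarev 1 ![y] ![M - M₀]
    (fun i ↦ by
      fin_cases i
      exact hyne)
    (fun i ↦ by
      fin_cases i
      intro _
      exact hy1)
    (fun i ↦ by
      fin_cases i
      exact ⟨ε, hε, τ_y τ_x⟩)
    (fun a ha i ↦ by
      rw [Fin.sum_univ_one] at ha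
      fin_cases i
      simpa using ha) 0
  have hyA : ((p : ℤ) ^ (M - M₀ - 1)) • y ∉ A ℓ := by
    have := (hloc 0).2 (by simp only [Matrix.cons_val_zero]; omega)
    simpa using this
  have hcL : ((p : ℤ) ^ (M - M₀ - 1)) • c ℓ ∉ Loc (pl ℓ) := fun h ↦
    hyA ((c_mem_loc_iff_one prime_of_kol c_one c_mem_loc_iff hℓ _).mp h)
  -- `k = expo c(ℓ) ≥ M - M₀`
  obtain ⟨k, hkM, hk, hkmin⟩ := exists_exact_exponent torsion (c ℓ)
  have hklo : M - M₀ ≤ k := by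
    by_contra hlt
    exact hcL (by rw [pow_zsmul_eq_zero_of_le (by omega) hk]; exact zero_mem _)
  have hk0 : k ≠ 0 := by omega
  have hk1 : ((p : ℤ) ^ (k - 1)) • c ℓ ≠ 0 := hkmin (k - 1) (by omega)
  -- Step B
  rcases exists_prime_stepB hp torsion x_ord hε τ_x cebotarev hτs hind hN0 hN hN1
      (τ_c_prime prime_of_kol τ_c hℓ) hk0 hk hk1 ℓ with
    ⟨ℓ', hlt, hℓ', hxA, hsA, hcA⟩ | ⟨u, -, hrel⟩
  swap
  · -- the socle configuration is excluded by `hsoc`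
    exfalso
    refine hk1 (hsoc ℓ hℓ (u * (p : ℤ) ^ (M - 1)) _ ?_)
    rw [hrel, smul_smul]
  -- Step C
  have hcℓ' : ((p : ℤ) ^ (M₀ + δ)) • c ℓ' = 0 :=
    pow_zsmul_c_eq_zero_defect hp torsion mem_sel_iff prime_of_kol dv_iff x_ord hε τ_x c_one τ_c
      c_mem_loc c_mem_loc_iff duality cebotarev hℓ' hxA
  have hA := stepC_defect prime_of_kol dv_iff dv_mul hε τ_c c_mem_loc c_mem_loc_iff duality hℓ hℓ'
    hlt.ne hcℓ' hkM (by omega) hcA hs hτs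
  have hle : N ≤ M - k + M₀ + 2 * δ := exact_exponent_le_of_mem hA (fun _ ↦ hsA)
  exact pow_zsmul_eq_zero_of_le (by omega) hN

end Summit.BirchSwinnertonDyer.BirchSwinnertonDyer.Theorems.SylvesterTwoUpper.DescentDefect

end
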